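import Literature.NumberTheory.Automorphic.InfUnitaryFactorialBoundOfIrrep             -- ★ (FB) `upq_factorialBound_of_isIrreducibleGK`, ★ `IsPosDefHerm`, ★ `Liu2021.LemD2.IsInfUnitary`, ★ `upqCasimirOp_eq_algebraMap_of_isIrreducibleGK`
import Literature.NumberTheory.Automorphic.GKModulesUnitaryIrreducibleSubmodule         -- ★ `GKSubmodule.exists_isIrreducibleGK_submodule`
import Literature.NumberTheory.Automorphic.HarishChandraSpaceDenseProofs               -- ★ `RealMatrixGroup.dense_harishChandraSpace`
import Literature.NumberTheory.Automorphic.DiscreteAutomorphicRepArchModule              -- ★ `inner_dπ_left_eq_neg` (dϖ skew-Hermitian for unitary ϖ); brings `GKModulesSmoothVectorsProofs`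
import Literature.Analysis.OperatorTheory.OneParameterAnalyticVector                    -- ★ `analyticAt_oneParam_apply_of_norm_le`
import HarnessLib

/-!
# Analytic vectors in an irreducible `(𝔤, K)`-submodule of the Harish-Chandra module of a unitary representation of `U(α, β)` — and the existence of such a
# submodule under admissibility (Harish-Chandra irreducibility for ADMISSIBLE unitary representations, part 1 of 2)

Topic `NumberTheory/Automorphic`; namespace `Literature.NumberTheory.Automorphic`.  THEOREMS ONLY (no definition, no instance, no notation, no named
fact, no `sorry`); axioms ⊆ {propext, Classical.choice, Quot.sound}.  Part 2 = ★ `UnitaryAdmissibleIrreducibleGlobalization` (density + recognition).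

THE MATHEMATICS ([HarishChandra1953, §9]; [KnappVogan1995, Thm. 0.6, Ch. IX §1]; [WallachRRG1, §3.3.1, Thm. 3.4.11]; [Nelson1959, §2]).  Let `G = U(α, β)`
(★ `uFormGroup α β`), `K` its maximal compact subgroup, `ϖ` a UNITARY strongly continuous representation of `G` on the Hilbert space `E`, `H_K^∞(ϖ)` its
Harish-Chandra module (★ `harishChandraSpace`, ★ `harishChandraRepK`, ★ `harishChandraRepLie`).
1. (§1) If `E ≠ 0` and `H_K^∞(ϖ)` is ADMISSIBLE (★ `IsAdmissibleGK (harishChandraRepK G ϖ)`), then `H_K^∞(ϖ)` has an IRREDUCIBLE `(𝔤, K)`-SUBMODULE: it is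
   non-zero (dense, ★ `RealMatrixGroup.dense_harishChandraSpace`), `K`-finite (★ `isGKModule_harishChandra_holds`), and the restricted inner product of `E` is
   positive, `K`-invariant (unitarity) with `𝔤` acting skew-Hermitian (★ `inner_dπ_left_eq_neg`), so ★ `GKSubmodule.exists_isIrreducibleGK_submodule` applies.
2. (§2) For ANY irreducible `(𝔤, K)`-submodule `U ≤ H_K^∞(ϖ)` (no admissibility needed): `U` is infinitesimally unitary (★ `Liu2021.LemD2.IsInfUnitary`) for the
   restricted inner product, hence the factorial bound (FB) ★ `upq_factorialBound_of_isIrreducibleGK` holds on `U` (Casimir scalar by Dixmier ★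
   `upqCasimirOp_eq_algebraMap_of_isIrreducibleGK`, generating `K`-type = `K`-span of a non-zero vector) IN THE NORM OF `E` (`‖emb v‖ = ‖v‖`):
   `‖dϖ(X)^m v‖ ≤ C · m! · (K‖X‖)^m`, so the orbit `t ↦ ϖ(exp tX) v` of every `v ∈ U` under the norm-preserving one-parameter group is REAL ANALYTIC (★
   `analyticAt_oneParam_apply_of_norm_le`), as is every matrix coefficient `t ↦ ⟪u, ϖ(exp tX) v⟫` — the argument of ★ `UnitaryGlobalizationAnalyticVectors` §2–§3
   run on the submodule `U` in place of all of `H_K^∞` of a globalization.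

* §0 `isAdmissibleGK_subrepresentation` — admissibility passes to `K`-submodules.
* §1 `exists_isIrreducibleGK_submodule_harishChandra`.
* §2 `isPosDefHerm_innerForm_submodule₂`, `norm_emb_innerForm_submodule₂`, `isInfUnitary_of_gkSubmodule_harishChandra`, `isInfUnitary_harishChandra`,
  `factorialBound_of_irreducible_submodule`, `norm_subLie_pow_le_of_irreducible_submodule`, `analyticAt_expMem_smul_apply_of_mem_irreducible_submodule`,
  `analyticAt_inner_expMem_smul_apply_of_mem_irreducible_submodule`.

Cell `hodgecm-mathlib`, F0∕P3 ROAD «TF», (n1)-junction «L-iso class half» (A-p14 (g26) census 2026-09-01, FILE A part 1).  HC_CM is proved only modulo the 2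
remaining named inputs (hLiu418, h413) until rung 0 closes; this file is unconditional.

## Mathlib ∕ tree search
Tree (all ★): `upq_factorialBound_of_isIrreducibleGK` (`UpqInfUnitaryFactorialBound`), `GKSubmodule.exists_isIrreducibleGK_submodule` (`GKModulesUnitaryIrreducibleSubmodule`),
`upqCasimirOp_eq_algebraMap_of_isIrreducibleGK` (`GKModulesDixmierSchur`), `GKSubmodule.isGKModule_sub` ∕ `subLie` (`GKSubquotient`), `isGKModule_harishChandra_holds`
(`GKModulesProofs`), `RealMatrixGroup.dense_harishChandraSpace` (`HarishChandraSpaceDenseProofs`), `IsPosDefHerm` ∕ `norm_emb_sq` (`InfUnitaryHilbertCompletion`),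
`hasDerivAt_dπ` ∕ `coe_harishChandraRepLie_apply` (`GKModulesSmoothVectorsProofs`), `inner_dπ_left_eq_neg` (`DiscreteAutomorphicRepArchModule` §0),
`analyticAt_oneParam_apply_of_norm_le` (`Literature/Analysis/OperatorTheory/OneParameterAnalyticVector`).  Mathlib: `Representation.IntertwiningMap.llcomp`,
`Submodule.dense_iff_topologicalClosure_eq_top`, `ContinuousLinearMap.analyticAt`, `List.ofFn_const`.  Dedup: `rg -n "of_mem_irreducible_submodule|isInfUnitary_harishChandra|
exists_isIrreducibleGK_submodule_harishChandra" lean/Literature lean/Summits` — no hits; (FB)∕analyticity FOR GLOBALIZATIONS is ★ `UnitaryGlobalizationAnalyticVectors`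
(hypothesis `IsUnitaryGlobalization`, i.e. irreducibility of the WHOLE `H_K^∞`, which is the conclusion of part 2 here).

## References
* Harish-Chandra, *Representations of a semisimple Lie group on a Banach space. I*, Trans. AMS 75 (1953), 185–243: §9 (Lemma 34, Thms. 5–6, Thm. 8) [HarishChandra1953].
* A. W. Knapp, D. A. Vogan, *Cohomological Induction and Unitary Representations*, Princeton (1995), Introduction (0.5), Thm. 0.6, Ch. IX §1 [KnappVogan1995].
* N. R. Wallach, *Real Reductive Groups I* (1988), §3.3.1, Thm. 3.4.11 [WallachRRG1].
* E. Nelson, *Analytic vectors*, Ann. of Math. 70 (1959), §2 [Nelson1959].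
* A. Borel, N. Wallach, *Continuous cohomology, discrete subgroups, and representations of reductive groups* (2000), 0 §2.5 [BorelWallach2000].
-/

-- Mathlib idiom (Mathlib/Algebra/Lie/OfAssociative.lean; as in ★ `GKModules`): the commutator bracket on `Module.End ℂ V` ∕ `Matrix N N ℂ`, needed
-- to MENTION `harishChandraRepLie … : 𝔤 →ₗ⁅ℝ⁆ Module.End ℂ _`.
attribute [local instance 100] LieRing.ofAssociativeRing

set_option autoImplicit false

noncomputable section

open scoped InnerProductSpace ComplexConjugate Matrix Matrix.Norms.Operator Nat
open Filter Topology

namespace Literature.NumberTheory.Automorphic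

open Literature.RepresentationTheory Literature.RepresentationTheory.KonnoKonno2007 Literature.RepresentationTheory.KonnoKonno2007.RealDualPair
open Literature.RepresentationTheory.BorelWallach2000
open ContRepresentation (ClosedSubrep)

variable {α β : Type} [Fintype α] [DecidableEq α] [Fintype β] [DecidableEq β]
  {E : Type} [NormedAddCommGroup E] [InnerProductSpace ℂ E] [CompleteSpace E]
  {ϖ : ContRepresentation ℂ (uFormGroup α β).carrier E}

/-! ## §0 Two generic transports -/

/-- **Admissibility passes to `K`-submodules** (composition with the injective inclusion is an injective linear map `Hom_K(τ, U) → Hom_K(τ, V)`).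
[cite: WallachRRG1, §3.3.1] -/
theorem isAdmissibleGK_subrepresentation {V : Type*} [AddCommGroup V] [Module ℂ V] {ρK : Representation ℂ (uFormGroup α β).maximalCompact V}
    (hadm : IsAdmissibleGK ρK) (U : Submodule ℂ V) (hU : ∀ k : (uFormGroup α β).maximalCompact, U ≤ U.comap (ρK k)) :
    IsAdmissibleGK (ρK.subrepresentation U hU) := by
  intro W _ _ _ τ hτ
  haveI := hadm W τ hτ
  let j : (ρK.subrepresentation U hU).IntertwiningMap ρK :=
    { toLinearMap := U.subtype
      isIntertwining' := fun k => LinearMap.ext fun u => rfl }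
  refine Module.Finite.of_injective (Representation.IntertwiningMap.llcomp τ _ _ j) fun S₁ S₂ hS => ?_
  refine Representation.IntertwiningMap.ext (LinearMap.ext fun w => Subtype.ext ?_)
  exact congrArg (fun S : τ.IntertwiningMap ρK => S w) hS

omit [CompleteSpace E] in
/-- A dense submodule of a non-trivial normed space is non-zero. [folklore] -/
private theorem nontrivial_of_dense_submodule [Nontrivial E] (S : Submodule ℂ E) (hS : Dense (S : Set E)) : Nontrivial S := by
  rw [Submodule.nontrivial_iff_ne_bot]
  rintro rfl
  have h : ((⊥ : Submodule ℂ E).topologicalClosure : Submodule ℂ E) = ⊤ := Submodule.dense_iff_topologicalClosure_eq_top.mp hS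
  have hcl : IsClosed ((⊥ : Submodule ℂ E) : Set E) := by
    rw [Submodule.bot_coe]
    exact isClosed_singleton
  rw [IsClosed.submodule_topologicalClosure_eq hcl] at h
  exact bot_ne_top h

/-! ## §1 An irreducible `(𝔤, K)`-submodule of the Harish-Chandra module of an admissible unitary representation -/

/-- **The Harish-Chandra module of an ADMISSIBLE unitary strongly continuous representation `ϖ ≠ 0` of `U(α, β)` has an IRREDUCIBLE `(𝔤, K)`-SUBMODULE**
(★ `GKSubmodule.exists_isIrreducibleGK_submodule` for `(H_K^∞(ϖ), ϖ|_K, dϖ)` — `K`-finite by ★ `isGKModule_harishChandra_holds`, non-zero by density ★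
`RealMatrixGroup.dense_harishChandraSpace`, with the restricted inner product: positive, `K`-invariant (unitarity), orthogonals of submodules `𝔤`-stable because
`dϖ(X)` is skew-Hermitian ★ `inner_dπ_left_eq_neg`). [cite: KnappVogan1995, Ch. IX §1] [cite: WallachRRG1, §3.3.1] [cite: HarishChandra1953, §9] -/
theorem exists_isIrreducibleGK_submodule_harishChandra [Nontrivial E] (hu : ϖ.IsUnitary) (hc : ϖ.IsStronglyContinuous)
    (hadm : IsAdmissibleGK (harishChandraRepK (uFormGroup α β) ϖ)) :
    ∃ (U : Submodule ℂ (harishChandraSpace (uFormGroup α β) ϖ))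
      (hU : IsGKSubmodule (harishChandraRepK (uFormGroup α β) ϖ) (harishChandraRepLie (uFormGroup α β) ϖ hc) U),
      IsIrreducibleGK ((harishChandraRepK (uFormGroup α β) ϖ).subrepresentation U fun k u hu' => hU.1 k u hu')
        (GKSubmodule.subLie (uFormGroup α β) (harishChandraRepLie (uFormGroup α β) ϖ hc) U fun X u hu' => hU.2 X u hu') := by
  -- §1-proof-begin
  set ρK := harishChandraRepK (uFormGroup α β) ϖ with hρK
  set ρ𝔤 := harishChandraRepLie (uFormGroup α β) ϖ hc with hρ𝔤
  have hV : IsGKModule (uFormGroup α β) ρK ρ𝔤 :=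
    isGKModule_harishChandra_holds (uFormGroup α β) ϖ hc ρK (fun _ _ => rfl) (isHarishChandraModuleOf_harishChandraRepLie (uFormGroup α β) ϖ hc)
  haveI : Nontrivial (harishChandraSpace (uFormGroup α β) ϖ) :=
    nontrivial_of_dense_submodule _ ((uFormGroup α β).dense_harishChandraSpace hu hc)
  -- the restricted inner product as a `Kuga.IsPosForm`
  have hip : Kuga.IsPosForm (fun v w : harishChandraSpace (uFormGroup α β) ϖ => ⟪(v : E), (w : E)⟫_ℂ) :=
    { add_left := fun x y z => by rw [Submodule.coe_add, inner_add_left]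
      smul_left := fun c x y => by rw [Submodule.coe_smul, inner_smul_left]
      conj_symm := fun x y => inner_conj_symm _ _
      nonneg := fun x => by rw [inner_self_eq_norm_sq_to_K]; exact_mod_cast sq_nonneg ‖(x : E)‖
      definite := fun x hx => by exact_mod_cast (inner_self_eq_zero.mp hx) }
  have hK : ∀ (k : (uFormGroup α β).maximalCompact) (v w : harishChandraSpace (uFormGroup α β) ϖ),
      ⟪((ρK k v : harishChandraSpace (uFormGroup α β) ϖ) : E), ((ρK k w : harishChandraSpace (uFormGroup α β) ϖ) : E)⟫_ℂ = ⟪(v : E), (w : E)⟫_ℂ :=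
    fun k v w => by
      rw [coe_harishChandraRepK_apply, coe_harishChandraRepK_apply]
      exact hu.inner_map_map _ _ _
  have h𝔤 : ∀ U : Submodule ℂ (harishChandraSpace (uFormGroup α β) ϖ), IsGKSubmodule ρK ρ𝔤 U →
      ∀ (X : (uFormGroup α β).lie) (v : harishChandraSpace (uFormGroup α β) ϖ),
        (∀ u ∈ U, ⟪(u : E), (v : E)⟫_ℂ = 0) → ∀ u ∈ U, ⟪(u : E), ((ρ𝔤 X v : harishChandraSpace (uFormGroup α β) ϖ) : E)⟫_ℂ = 0 := by
    intro U hU X v hv u hu'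
    have h1 : ⟪((ρ𝔤 X u : harishChandraSpace (uFormGroup α β) ϖ) : E), (v : E)⟫_ℂ = 0 := hv _ (hU.2 X u hu')
    rw [coe_harishChandraRepLie_apply, inner_dπ_left_eq_neg (uFormGroup α β) ϖ hu u.2.1 v.2.1 X, neg_eq_zero] at h1
    rw [coe_harishChandraRepLie_apply]
    exact h1
  exact GKSubmodule.exists_isIrreducibleGK_submodule (G := uFormGroup α β) ρK ρ𝔤 hV.kFinite hadm hip hK h𝔤
  -- §1-proof-end

/-! ## §2 (FB) and analyticity on an irreducible `(𝔤, K)`-submodule of the Harish-Chandra module -/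

section Submodule

variable (hu : ϖ.IsUnitary) (hc : ϖ.IsStronglyContinuous)
  (U : Submodule ℂ (harishChandraSpace (uFormGroup α β) ϖ))
  (hUK : ∀ k : (uFormGroup α β).maximalCompact, U ≤ U.comap (harishChandraRepK (uFormGroup α β) ϖ k))
  (hU𝔤 : ∀ X : (uFormGroup α β).lie, U ≤ U.comap (harishChandraRepLie (uFormGroup α β) ϖ hc X))
  (hirr : IsIrreducibleGK ((harishChandraRepK (uFormGroup α β) ϖ).subrepresentation U hUK)
    (GKSubmodule.subLie (uFormGroup α β) (harishChandraRepLie (uFormGroup α β) ϖ hc) U hU𝔤))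

omit [CompleteSpace E] in
/-- The restricted inner product of `E` on a submodule `U ≤ H_K^∞(ϖ)` (two inclusion levels) is a positive definite Hermitian form (★ `IsPosDefHerm`).
[cite: KnappVogan1995, Introduction (0.5)] -/
theorem isPosDefHerm_innerForm_submodule₂ :
    IsPosDefHerm ((((innerₛₗ ℂ (E := E)).comp ((harishChandraSpace (uFormGroup α β) ϖ).subtype ∘ₗ U.subtype)).compl₂
      ((harishChandraSpace (uFormGroup α β) ϖ).subtype ∘ₗ U.subtype) : U →ₗ⋆[ℂ] U →ₗ[ℂ] ℂ)) := by
  refine ⟨fun v w => ?_, fun v hv => ?_⟩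
  · change ⟪((v : harishChandraSpace (uFormGroup α β) ϖ) : E), ((w : harishChandraSpace (uFormGroup α β) ϖ) : E)⟫_ℂ =
      conj ⟪((w : harishChandraSpace (uFormGroup α β) ϖ) : E), ((v : harishChandraSpace (uFormGroup α β) ϖ) : E)⟫_ℂ
    exact (inner_conj_symm _ _).symm
  · change 0 < (⟪((v : harishChandraSpace (uFormGroup α β) ϖ) : E), ((v : harishChandraSpace (uFormGroup α β) ϖ) : E)⟫_ℂ).re
    rw [inner_self_eq_norm_sq_to_K]
    have hv' : ((v : harishChandraSpace (uFormGroup α β) ϖ) : E) ≠ 0 := fun h =>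
      hv (Subtype.ext (Subtype.ext (by simpa using h)))
    have h : (0 : ℝ) < ‖((v : harishChandraSpace (uFormGroup α β) ϖ) : E)‖ ^ 2 := by positivity
    exact_mod_cast h

omit [CompleteSpace E] in
/-- `‖emb v‖ = ‖v‖_E` for the restricted form on `U ≤ H_K^∞(ϖ)` (★ `IsPosDefHerm.norm_emb_sq`). [cite: KnappVogan1995, Introduction (0.5)] -/
theorem norm_emb_innerForm_submodule₂ (v : U) :
    ‖(isPosDefHerm_innerForm_submodule₂ (ϖ := ϖ) U).emb v‖ = ‖((v : harishChandraSpace (uFormGroup α β) ϖ) : E)‖ := by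
  have h := (isPosDefHerm_innerForm_submodule₂ (ϖ := ϖ) U).norm_emb_sq v
  have h' : ((((innerₛₗ ℂ (E := E)).comp ((harishChandraSpace (uFormGroup α β) ϖ).subtype ∘ₗ U.subtype)).compl₂
      ((harishChandraSpace (uFormGroup α β) ϖ).subtype ∘ₗ U.subtype) : U →ₗ⋆[ℂ] U →ₗ[ℂ] ℂ) v v).re =
        ‖((v : harishChandraSpace (uFormGroup α β) ϖ) : E)‖ ^ 2 := by
    change (⟪((v : harishChandraSpace (uFormGroup α β) ϖ) : E), ((v : harishChandraSpace (uFormGroup α β) ϖ) : E)⟫_ℂ).re = _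
    rw [inner_self_eq_norm_sq_to_K]
    norm_cast
  rw [h'] at h
  exact (pow_left_inj₀ (norm_nonneg _) (norm_nonneg _) two_ne_zero).mp h

include hu in
/-- **A `(𝔤, K)`-submodule `U ≤ H_K^∞(ϖ)` of a unitary `ϖ` is INFINITESIMALLY UNITARY** (★ `Liu2021.LemD2.IsInfUnitary`) for the restricted inner product of
`E`: Hermitian, positive, `𝔤`-skew (★ `inner_dπ_left_eq_neg`) and `K`-invariant (unitarity). [cite: BorelWallach2000, 0 §2.5] [cite: KnappVogan1995, Introduction (0.5)] -/
theorem isInfUnitary_of_gkSubmodule_harishChandra :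
    Liu2021.LemD2.IsInfUnitary ((harishChandraRepK (uFormGroup α β) ϖ).subrepresentation U hUK)
      (GKSubmodule.subLie (uFormGroup α β) (harishChandraRepLie (uFormGroup α β) ϖ hc) U hU𝔤) := by
  refine ⟨(((innerₛₗ ℂ (E := E)).comp ((harishChandraSpace (uFormGroup α β) ϖ).subtype ∘ₗ U.subtype)).compl₂
      ((harishChandraSpace (uFormGroup α β) ϖ).subtype ∘ₗ U.subtype) : U →ₗ⋆[ℂ] U →ₗ[ℂ] ℂ),
    (isPosDefHerm_innerForm_submodule₂ (ϖ := ϖ) U).herm, (isPosDefHerm_innerForm_submodule₂ (ϖ := ϖ) U).pos, fun Y x y => ?_, fun k x y => ?_⟩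
  · change ⟪((harishChandraRepLie (uFormGroup α β) ϖ hc Y (x : harishChandraSpace (uFormGroup α β) ϖ) : harishChandraSpace (uFormGroup α β) ϖ) : E),
        ((y : harishChandraSpace (uFormGroup α β) ϖ) : E)⟫_ℂ =
      -⟪((x : harishChandraSpace (uFormGroup α β) ϖ) : E),
        ((harishChandraRepLie (uFormGroup α β) ϖ hc Y (y : harishChandraSpace (uFormGroup α β) ϖ) : harishChandraSpace (uFormGroup α β) ϖ) : E)⟫_ℂ
    rw [coe_harishChandraRepLie_apply, coe_harishChandraRepLie_apply]
    exact inner_dπ_left_eq_neg (uFormGroup α β) ϖ hu (x : harishChandraSpace (uFormGroup α β) ϖ).2.1 (y : harishChandraSpace (uFormGroup α β) ϖ).2.1 Y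
  · change ⟪((harishChandraRepK (uFormGroup α β) ϖ k (x : harishChandraSpace (uFormGroup α β) ϖ) : harishChandraSpace (uFormGroup α β) ϖ) : E),
        ((harishChandraRepK (uFormGroup α β) ϖ k (y : harishChandraSpace (uFormGroup α β) ϖ) : harishChandraSpace (uFormGroup α β) ϖ) : E)⟫_ℂ =
      ⟪((x : harishChandraSpace (uFormGroup α β) ϖ) : E), ((y : harishChandraSpace (uFormGroup α β) ϖ) : E)⟫_ℂ
    rw [coe_harishChandraRepK_apply, coe_harishChandraRepK_apply]
    exact hu.inner_map_map _ _ _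

include hu in
omit hUK hU𝔤 in
/-- **The Harish-Chandra module of a unitary representation of `U(α, β)` is INFINITESIMALLY UNITARY** (★ `Liu2021.LemD2.IsInfUnitary`) for the restricted inner
product (the case `U = ⊤` of `isInfUnitary_of_gkSubmodule_harishChandra`, stated for the module `H_K^∞(ϖ)` itself). [cite: BorelWallach2000, 0 §2.5] -/
theorem isInfUnitary_harishChandra :
    Liu2021.LemD2.IsInfUnitary (harishChandraRepK (uFormGroup α β) ϖ) (harishChandraRepLie (uFormGroup α β) ϖ hc) := by
  refine ⟨(((innerₛₗ ℂ (E := E)).comp (harishChandraSpace (uFormGroup α β) ϖ).subtype).compl₂ (harishChandraSpace (uFormGroup α β) ϖ).subtype :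
      harishChandraSpace (uFormGroup α β) ϖ →ₗ⋆[ℂ] harishChandraSpace (uFormGroup α β) ϖ →ₗ[ℂ] ℂ), fun x y => ?_, fun x hx => ?_, fun Y x y => ?_, fun k x y => ?_⟩
  · change ⟪(x : E), (y : E)⟫_ℂ = conj ⟪(y : E), (x : E)⟫_ℂ
    exact (inner_conj_symm _ _).symm
  · change 0 < (⟪(x : E), (x : E)⟫_ℂ).re
    rw [inner_self_eq_norm_sq_to_K]
    have hx' : (x : E) ≠ 0 := fun h => hx (Subtype.ext (by simpa using h))
    have h : (0 : ℝ) < ‖(x : E)‖ ^ 2 := by positivity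
    exact_mod_cast h
  · change ⟪((harishChandraRepLie (uFormGroup α β) ϖ hc Y x : harishChandraSpace (uFormGroup α β) ϖ) : E), (y : E)⟫_ℂ =
      -⟪(x : E), ((harishChandraRepLie (uFormGroup α β) ϖ hc Y y : harishChandraSpace (uFormGroup α β) ϖ) : E)⟫_ℂ
    rw [coe_harishChandraRepLie_apply, coe_harishChandraRepLie_apply]
    exact inner_dπ_left_eq_neg (uFormGroup α β) ϖ hu x.2.1 y.2.1 Y
  · change ⟪((harishChandraRepK (uFormGroup α β) ϖ k x : harishChandraSpace (uFormGroup α β) ϖ) : E),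
        ((harishChandraRepK (uFormGroup α β) ϖ k y : harishChandraSpace (uFormGroup α β) ϖ) : E)⟫_ℂ = ⟪(x : E), (y : E)⟫_ℂ
    rw [coe_harishChandraRepK_apply, coe_harishChandraRepK_apply]
    exact hu.inner_map_map _ _ _

include hu hirr in
/-- **(FB) ON AN IRREDUCIBLE `(𝔤, K)`-SUBMODULE `U ≤ H_K^∞(ϖ)` of a unitary `ϖ`**, in the norm of `E`:
`∃ K ≥ 0, ∀ v ∈ U, ∃ C, ∀ m (X : Fin m → 𝔤), ‖dϖ(X₀) ⋯ dϖ(X_{m−1}) v‖ ≤ C · m! · K^m · ∏ ‖X_i‖` (★ `upq_factorialBound_of_isIrreducibleGK` for the module `U`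
— ★ `GKSubmodule.isGKModule_sub` — with the restricted inner product, the Casimir scalar ★ `upqCasimirOp_eq_algebraMap_of_isIrreducibleGK` and the `K`-span of
a non-zero vector as generating `K`-type). [cite: HarishChandra1953, §9] [cite: Nelson1959, §2] [cite: KnappVogan1995, Thm. 0.6] -/
theorem factorialBound_of_irreducible_submodule [Nonempty α] [Nonempty β] :
    ∃ K : ℝ, 0 ≤ K ∧ ∀ v : U, ∃ C : ℝ, ∀ (m : ℕ) (X : Fin m → (uFormGroup α β).lie),
      ‖((((List.ofFn fun i => (GKSubmodule.subLie (uFormGroup α β) (harishChandraRepLie (uFormGroup α β) ϖ hc) U hU𝔤 (X i) :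
            Module.End ℂ U)).prod v : U) : harishChandraSpace (uFormGroup α β) ϖ) : E)‖ ≤
        C * m ! * K ^ m * ∏ i, ‖((X i : (uFormGroup α β).lie) : Matrix (α ⊕ β) (α ⊕ β) ℂ)‖ := by
  set ρK := (harishChandraRepK (uFormGroup α β) ϖ).subrepresentation U hUK with hρK
  set ρ𝔤 := GKSubmodule.subLie (uFormGroup α β) (harishChandraRepLie (uFormGroup α β) ϖ hc) U hU𝔤 with hρ𝔤
  have hV₀ : IsGKModule (uFormGroup α β) (harishChandraRepK (uFormGroup α β) ϖ) (harishChandraRepLie (uFormGroup α β) ϖ hc) :=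
    isGKModule_harishChandra_holds (uFormGroup α β) ϖ hc _ (fun _ _ => rfl) (isHarishChandraModuleOf_harishChandraRepLie (uFormGroup α β) ϖ hc)
  have hV : IsGKModule (uFormGroup α β) ρK ρ𝔤 := GKSubmodule.isGKModule_sub (uFormGroup α β) _ _ U hUK hU𝔤 hV₀
  -- the restricted inner product
  have hB := isPosDefHerm_innerForm_submodule₂ (ϖ := ϖ) U
  have hskew : ∀ (Y : (uFormGroup α β).lie) (x y : U),
      ((((innerₛₗ ℂ (E := E)).comp ((harishChandraSpace (uFormGroup α β) ϖ).subtype ∘ₗ U.subtype)).compl₂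
        ((harishChandraSpace (uFormGroup α β) ϖ).subtype ∘ₗ U.subtype) : U →ₗ⋆[ℂ] U →ₗ[ℂ] ℂ)) (ρ𝔤 Y x) y =
      -((((innerₛₗ ℂ (E := E)).comp ((harishChandraSpace (uFormGroup α β) ϖ).subtype ∘ₗ U.subtype)).compl₂
        ((harishChandraSpace (uFormGroup α β) ϖ).subtype ∘ₗ U.subtype) : U →ₗ⋆[ℂ] U →ₗ[ℂ] ℂ)) x (ρ𝔤 Y y) := fun Y x y => by
    change ⟪((harishChandraRepLie (uFormGroup α β) ϖ hc Y (x : harishChandraSpace (uFormGroup α β) ϖ) : harishChandraSpace (uFormGroup α β) ϖ) : E),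
        ((y : harishChandraSpace (uFormGroup α β) ϖ) : E)⟫_ℂ =
      -⟪((x : harishChandraSpace (uFormGroup α β) ϖ) : E),
        ((harishChandraRepLie (uFormGroup α β) ϖ hc Y (y : harishChandraSpace (uFormGroup α β) ϖ) : harishChandraSpace (uFormGroup α β) ϖ) : E)⟫_ℂ
    rw [coe_harishChandraRepLie_apply, coe_harishChandraRepLie_apply]
    exact inner_dπ_left_eq_neg (uFormGroup α β) ϖ hu (x : harishChandraSpace (uFormGroup α β) ϖ).2.1 (y : harishChandraSpace (uFormGroup α β) ϖ).2.1 Y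
  have hKu : ∀ (k : (uFormGroup α β).maximalCompact) (x y : U),
      ((((innerₛₗ ℂ (E := E)).comp ((harishChandraSpace (uFormGroup α β) ϖ).subtype ∘ₗ U.subtype)).compl₂
        ((harishChandraSpace (uFormGroup α β) ϖ).subtype ∘ₗ U.subtype) : U →ₗ⋆[ℂ] U →ₗ[ℂ] ℂ)) (ρK k x) (ρK k y) =
      ((((innerₛₗ ℂ (E := E)).comp ((harishChandraSpace (uFormGroup α β) ϖ).subtype ∘ₗ U.subtype)).compl₂
        ((harishChandraSpace (uFormGroup α β) ϖ).subtype ∘ₗ U.subtype) : U →ₗ⋆[ℂ] U →ₗ[ℂ] ℂ)) x y := fun k x y => by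
    change ⟪((harishChandraRepK (uFormGroup α β) ϖ k (x : harishChandraSpace (uFormGroup α β) ϖ) : harishChandraSpace (uFormGroup α β) ϖ) : E),
        ((harishChandraRepK (uFormGroup α β) ϖ k (y : harishChandraSpace (uFormGroup α β) ϖ) : harishChandraSpace (uFormGroup α β) ϖ) : E)⟫_ℂ =
      ⟪((x : harishChandraSpace (uFormGroup α β) ϖ) : E), ((y : harishChandraSpace (uFormGroup α β) ϖ) : E)⟫_ℂ
    rw [coe_harishChandraRepK_apply, coe_harishChandraRepK_apply]
    exact hu.inner_map_map _ _ _
  -- Casimir scalar (Dixmier)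
  obtain ⟨c, hcas⟩ := upqCasimirOp_eq_algebraMap_of_isIrreducibleGK hV hirr
  have hcas' : ∀ v : U, upqCasimirOp ρ𝔤 v = c • v := fun v => by rw [hcas, Module.algebraMap_end_apply]
  -- a generating `K`-type: the `K`-span of a non-zero vector
  haveI := hirr.nontrivial
  obtain ⟨v₀, hv₀⟩ := exists_ne (0 : U)
  let W₀ : Submodule ℂ U := Submodule.span ℂ (Set.range fun k : (uFormGroup α β).maximalCompact => ρK k v₀)
  haveI : FiniteDimensional ℂ W₀ := hV.kFinite v₀
  have hW₀K : ∀ (k : (uFormGroup α β).maximalCompact), ∀ w ∈ W₀, ρK k w ∈ W₀ := fun k w hw =>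
    GKTensor.kOrbitSpan_stable (uFormGroup α β) ρK v₀ k hw
  have hW₀ne : W₀ ≠ ⊥ := fun h => hv₀ ((Submodule.eq_bot_iff _).mp h v₀ (IsGKModule.mem_span_orbit_self v₀))
  obtain ⟨K, hK, hFB⟩ := upq_factorialBound_of_isIrreducibleGK ρK ρ𝔤 hV hirr hB hskew hKu hcas' W₀ hW₀K hW₀ne
  refine ⟨K, hK, fun v => ?_⟩
  obtain ⟨C, hC⟩ := hFB v
  refine ⟨C, fun m X => ?_⟩
  rw [← norm_emb_innerForm_submodule₂]
  exact hC m X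

/-- `List.ofFn` of a constant function has product the power. [folklore] -/
private theorem prod_ofFn_const' {M : Type*} [Monoid M] (a : M) (m : ℕ) : (List.ofFn fun _ : Fin m => a).prod = a ^ m := by
  rw [List.ofFn_const, List.prod_replicate]

include hu hirr in
/-- **(FB) along one direction** on an irreducible submodule `U ≤ H_K^∞(ϖ)`: `∃ K ≥ 0, ∀ v ∈ U, ∃ C, ∀ m X, ‖dϖ(X)^m v‖ ≤ C · m! · (K‖X‖)^m`.
[cite: HarishChandra1953, §9] [cite: Nelson1959, §2] -/
theorem norm_subLie_pow_le_of_irreducible_submodule [Nonempty α] [Nonempty β] :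
    ∃ K : ℝ, 0 ≤ K ∧ ∀ v : U, ∃ C : ℝ, ∀ (m : ℕ) (X : (uFormGroup α β).lie),
      ‖(((((GKSubmodule.subLie (uFormGroup α β) (harishChandraRepLie (uFormGroup α β) ϖ hc) U hU𝔤 X : Module.End ℂ U) ^ m) v : U) :
          harishChandraSpace (uFormGroup α β) ϖ) : E)‖ ≤
        C * m ! * (K * ‖((X : (uFormGroup α β).lie) : Matrix (α ⊕ β) (α ⊕ β) ℂ)‖) ^ m := by
  obtain ⟨K, hK, h⟩ := factorialBound_of_irreducible_submodule hu hc U hUK hU𝔤 hirr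
  refine ⟨K, hK, fun v => ?_⟩
  obtain ⟨C, hC⟩ := h v
  refine ⟨C, fun m X => ?_⟩
  have h1 := hC m (fun _ => X)
  rw [prod_ofFn_const', Finset.prod_const, Finset.card_univ, Fintype.card_fin] at h1
  calc _ ≤ C * m ! * K ^ m * ‖((X : (uFormGroup α β).lie) : Matrix (α ⊕ β) (α ⊕ β) ℂ)‖ ^ m := h1
    _ = C * m ! * (K * ‖((X : (uFormGroup α β).lie) : Matrix (α ⊕ β) (α ⊕ β) ℂ)‖) ^ m := by rw [mul_pow]; ring

omit [CompleteSpace E] in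
/-- `ϖ(exp ((s+t)X)) = ϖ(exp (sX)) ∘ ϖ(exp (tX))` (one-parameter law, ★ `expGL_add_smul`). [folklore] -/
private theorem apply_expMem_add_smul'' (X : (uFormGroup α β).lie) (s t : ℝ) (v : E) :
    ϖ ((uFormGroup α β).expMem ((s + t) • X)) v = ϖ ((uFormGroup α β).expMem (s • X)) (ϖ ((uFormGroup α β).expMem (t • X)) v) := by
  have h : (uFormGroup α β).expMem ((s + t) • X) = (uFormGroup α β).expMem (s • X) * (uFormGroup α β).expMem (t • X) := by
    refine Subtype.ext ?_
    change expGL (((s + t) • X : (uFormGroup α β).lie) : Matrix (α ⊕ β) (α ⊕ β) ℂ) =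
      expGL ((s • X : (uFormGroup α β).lie) : Matrix (α ⊕ β) (α ⊕ β) ℂ) * expGL ((t • X : (uFormGroup α β).lie) : Matrix (α ⊕ β) (α ⊕ β) ℂ)
    exact expGL_add_smul s t (X : Matrix (α ⊕ β) (α ⊕ β) ℂ)
  rw [h, map_mul]
  rfl

include hu hirr in
/-- **THE ORBIT `t ↦ ϖ(exp tX) v` OF A VECTOR OF AN IRREDUCIBLE `(𝔤, K)`-SUBMODULE `U ≤ H_K^∞(ϖ)` OF A UNITARY `ϖ` IS REAL ANALYTIC** at every `t₀ ∈ ℝ`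
(★ `analyticAt_oneParam_apply_of_norm_le` with `U t = ϖ(exp tX)` norm-preserving, `w_k = dϖ(X)^k v ∈ U`, `d/dt|₀ U t w_k = w_{k+1}` by ★ `hasDerivAt_dπ`, and
`‖w_k‖ ≤ C · (K‖X‖)^k · k!`). [cite: HarishChandra1953, §9 (Lemma 34, Thm. 8)] [cite: Nelson1959, §2] -/
theorem analyticAt_expMem_smul_apply_of_mem_irreducible_submodule [Nonempty α] [Nonempty β]
    {v : E} (hv : v ∈ U.map (harishChandraSpace (uFormGroup α β) ϖ).subtype) (X : (uFormGroup α β).lie) (t₀ : ℝ) :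
    AnalyticAt ℝ (fun t : ℝ => ϖ ((uFormGroup α β).expMem (t • X)) v) t₀ := by
  obtain ⟨K, hK, h⟩ := norm_subLie_pow_le_of_irreducible_submodule hu hc U hUK hU𝔤 hirr
  obtain ⟨v', hv'U, rfl⟩ := hv
  obtain ⟨C, hC⟩ := h ⟨v', hv'U⟩
  -- the derivative sequence `w k = dϖ(X)^k v`
  let L : Module.End ℂ U := GKSubmodule.subLie (uFormGroup α β) (harishChandraRepLie (uFormGroup α β) ϖ hc) U hU𝔤 X
  let w : ℕ → E := fun k => ((((L ^ k) ⟨v', hv'U⟩ : U) : harishChandraSpace (uFormGroup α β) ϖ) : E)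
  have hw0 : w 0 = (v' : E) := by simp [w]
  have hw : ∀ k, HasDerivAt (fun t : ℝ => ((ϖ ((uFormGroup α β).expMem (t • X))).restrictScalars ℝ) (w k)) (w (k + 1)) 0 := by
    intro k
    have hmem : w k ∈ harishChandraSpace (uFormGroup α β) ϖ := (((L ^ k) ⟨v', hv'U⟩ : U) : harishChandraSpace (uFormGroup α β) ϖ).2
    have hd := hasDerivAt_dπ (uFormGroup α β) ϖ (differentiableAt_of_mem_smoothVectors (uFormGroup α β) ϖ hmem.1) X
    have heq : w (k + 1) = dπ (uFormGroup α β) ϖ (w k) X := by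
      change ((((L ^ (k + 1)) ⟨v', hv'U⟩ : U) : harishChandraSpace (uFormGroup α β) ϖ) : E) = _
      rw [pow_succ', Module.End.mul_apply]
      exact coe_harishChandraRepLie_apply (uFormGroup α β) ϖ hc X _
    rw [heq]
    exact hd
  have hb : ∀ k, ‖w k‖ ≤ C * (K * ‖((X : (uFormGroup α β).lie) : Matrix (α ⊕ β) (α ⊕ β) ℂ)‖) ^ k * k ! := fun k => by
    have h1 := hC k X
    calc ‖w k‖ ≤ C * k ! * (K * ‖((X : (uFormGroup α β).lie) : Matrix (α ⊕ β) (α ⊕ β) ℂ)‖) ^ k := h1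
      _ = C * (K * ‖((X : (uFormGroup α β).lie) : Matrix (α ⊕ β) (α ⊕ β) ℂ)‖) ^ k * k ! := by ring
  have hU' : ∀ (s t : ℝ) (u : E), ((ϖ ((uFormGroup α β).expMem ((s + t) • X))).restrictScalars ℝ) u =
      ((ϖ ((uFormGroup α β).expMem (s • X))).restrictScalars ℝ) (((ϖ ((uFormGroup α β).expMem (t • X))).restrictScalars ℝ) u) :=
    fun s t u => apply_expMem_add_smul'' X s t u
  have hBd : ∀ (t : ℝ) (u : E), ‖((ϖ ((uFormGroup α β).expMem (t • X))).restrictScalars ℝ) u‖ ≤ 1 * ‖u‖ := fun t u => by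
    rw [one_mul, ContinuousLinearMap.coe_restrictScalars', hu.norm_map]
  have han := Literature.Analysis.OperatorTheory.analyticAt_oneParam_apply_of_norm_le
    (fun t : ℝ => (ϖ ((uFormGroup α β).expMem (t • X))).restrictScalars ℝ) hU' hBd w hw hb t₀
  rw [hw0] at han
  exact han

include hu hirr in
/-- **Every matrix coefficient `t ↦ ⟪u, ϖ(exp tX) v⟫` of a vector of an irreducible `(𝔤, K)`-submodule `U ≤ H_K^∞(ϖ)` is real analytic** — the
hypothesis `hana` of ★ `areUnitarilyEquivalent_closure_of_isometricLieIntertwiner` for `S = U`. [cite: HarishChandra1953, §9 (Lemma 34, Thm. 8)] [cite: Nelson1959, §2] -/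
theorem analyticAt_inner_expMem_smul_apply_of_mem_irreducible_submodule [Nonempty α] [Nonempty β]
    {v : E} (hv : v ∈ U.map (harishChandraSpace (uFormGroup α β) ϖ).subtype) (u : E) (X : (uFormGroup α β).lie) (t₀ : ℝ) :
    AnalyticAt ℝ (fun t : ℝ => ⟪u, ϖ ((uFormGroup α β).expMem (t • X)) v⟫_ℂ) t₀ := by
  have h := analyticAt_expMem_smul_apply_of_mem_irreducible_submodule hu hc U hUK hU𝔤 hirr hv X t₀
  have hL : AnalyticAt ℝ (fun y : E => ((innerSL ℂ u).restrictScalars ℝ) y) (ϖ ((uFormGroup α β).expMem (t₀ • X)) v) :=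
    ((innerSL ℂ u).restrictScalars ℝ).analyticAt _
  exact AnalyticAt.comp (f := fun t : ℝ => ϖ ((uFormGroup α β).expMem (t • X)) v) (x := t₀) hL h

end Submodule

end Literature.NumberTheory.Automorphic

end
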